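import Summits.BirchSwinnertonDyer.BirchSwinnertonDyer.Theorems.ManinLocalTwoThreeUDCGlue
import HarnessLib

/-!
# `q`-expansions valid high in the strip extend to the whole upper half-plane — glue for the C3 modular-form witness
(route `ManinLocalTwoThree`, crux C3 `ManinPrimeToThreeAtNine` stmt-BirchSwinnertonDyer-22968; cell bsd-f2-manin, C3 LEAD p1 gen 15;
`--supports stmt-BirchSwinnertonDyer-22968`)

The UDC line's modular-form witness (C3 skeleton v23 `stub_kummerCubeRootModularFormWitness`, MEMO-an §80.12 step (6)) must hand
an's `UDCKummerLine.UnboundedDenominatorsWeight k` a holomorphic `F : ℍ → ℂ` whose INTEGER `q`-series `Σ bₙ e^{2πiτn}` sums to `F τ`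
for EVERY `τ ∈ ℍ`, while the analytic identification of the Kummer cube root (p2 g17, `KummerCubeRootDictionary.exists_hasSum_…`,
p727203/p727852) produces the series only for `Im τ > B`.  This file closes that gap once and for all (pure complex analysis):

* `periodic_comp_ofComplex_of_hasSum` — a holomorphic `f : ℍ → ℂ` given by a `q`-series for `Im τ > B` is `1`-periodic
  (identity theorem on the connected open upper half-plane);
* `isBoundedAtImInfty_of_hasSum` — such an `f` is bounded at `i∞` (geometric domination of the series);
* `hasSum_of_hasSum_of_lt_im` — the SAME series sums to `f τ` for every `τ ∈ ℍ` (Mathlib's `UpperHalfPlane.hasSum_qExpansion` for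
  bare functions + uniqueness of the power series of the cusp function at `q = 0`);
* `hasSum_exp_of_hasSum_of_lt_im` — the same in the `Complex.exp (2π i τ n)` spelling of `UnboundedDenominatorsWeight`;
* `kummerCubeRootCongruenceOfBoundedOfUDC_of_modularFormWitness_of_lt_im` — hence the C3 glue
  `kummerCubeRootCongruenceOfBoundedOfUDC_of_modularFormWitness` (p727487) already follows from a witness whose integer `q`-expansion
  is only known for `Im τ > B` (the RELAXED witness law of skeleton v24).

HONEST FRAMING.  Glue only (folklore complex analysis); (AN2) itself, C3, Manin's conjecture and BSD are NOT proved here.  No definitions,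
no sorry. [folklore]
-/

set_option autoImplicit false
-- lint-debt: the directory name repeats the summit name (sibling precedent `ManinLocalTwoThreeUDCGlue.lean`)
set_option linter.dupNamespace false

noncomputable section

open Complex Filter Function Metric Set UpperHalfPlane
open scoped Real Topology Manifold MatrixGroups ModularForm

namespace Summit.BirchSwinnertonDyer.BirchSwinnertonDyer.Theorems.ManinLocalTwoThree.QExpansionExtension

/-! ## §1 The parameter `q = e^{2πiτ}` -/

/-- `q(z + 1) = q(z)`. [folklore] -/
theorem qParam_add_one (z : ℂ) : Periodic.qParam 1 (z + 1) = Periodic.qParam 1 z := by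
  simp only [Periodic.qParam, ofReal_one, div_one]
  rw [mul_add, Complex.exp_add, mul_one, exp_two_pi_mul_I, mul_one]

/-- `e^{2πiτn} = q(τ)ⁿ`. [folklore] -/
theorem exp_eq_qParam_pow (τ : ℂ) (n : ℕ) :
    Complex.exp (2 * Real.pi * Complex.I * τ * n) = Periodic.qParam 1 τ ^ n := by
  simp only [Periodic.qParam, ofReal_one, div_one]
  rw [← Complex.exp_nat_mul]
  ring_nf

/-- `‖q(τ)‖ = e^{−2π Im τ}` on `ℍ`. [folklore] -/
theorem norm_qParam_one (τ : ℍ) : ‖Periodic.qParam 1 (τ : ℂ)‖ = Real.exp (-(2 * Real.pi * τ.im)) := by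
  rw [Periodic.norm_qParam, div_one, coe_im]
  ring_nf

variable {f : ℍ → ℂ} {c : ℕ → ℂ} {B : ℝ}

/-! ## §2 Periodicity by the identity theorem -/

/-- If `Σ cₘ q(τ)ᵐ` sums to `f τ` whenever `Im τ > B`, then `f (τ + 1) = f τ` for those `τ`. [folklore] -/
theorem apply_eq_of_hasSum_of_lt_im (hs : ∀ τ : ℍ, B < τ.im → HasSum (fun m ↦ c m * Periodic.qParam 1 (τ : ℂ) ^ m) (f τ))
    {z : ℂ} (hz : 0 < z.im) (hB : B < z.im) :
    f ⟨z + 1, by simpa using hz⟩ = f ⟨z, hz⟩ := by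
  have h1 := hs ⟨z + 1, by simpa using hz⟩ (by simpa using hB)
  have h2 := hs ⟨z, hz⟩ hB
  have h1' : HasSum (fun m ↦ c m * Periodic.qParam 1 z ^ m) (f ⟨z + 1, by simpa using hz⟩) := by
    convert h1 using 2 with m
    simp [qParam_add_one]
  exact h1'.unique (by simpa using h2)

/-- **Periodicity.**  A holomorphic `f : ℍ → ℂ` given by a `q`-series for `Im τ > B` satisfies `f(z + 1) = f(z)` on all of `ℍ`
(extended to `ℂ` by Mathlib's `ofComplex` junk value below the real axis). [folklore] -/
theorem periodic_comp_ofComplex_of_hasSum (hf : MDifferentiable 𝓘(ℂ) 𝓘(ℂ) f)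
    (hs : ∀ τ : ℍ, B < τ.im → HasSum (fun m ↦ c m * Periodic.qParam 1 (τ : ℂ) ^ m) (f τ)) :
    Periodic (f ∘ ofComplex) 1 := by
  -- the two holomorphic functions `F` and `F(· + 1)` on the open upper half-plane agree high up, hence everywhere
  set F : ℂ → ℂ := f ∘ ofComplex with hFdef
  have hF : DifferentiableOn ℂ F upperHalfPlaneSet := UpperHalfPlane.mdifferentiable_iff.mp hf
  have hmaps : MapsTo (fun z : ℂ ↦ z + 1) upperHalfPlaneSet upperHalfPlaneSet := fun z hz ↦ by
    simpa [upperHalfPlaneSet] using hz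
  have hG : DifferentiableOn ℂ (fun z ↦ F (z + 1)) upperHalfPlaneSet :=
    hF.comp ((differentiable_id.add_const (1 : ℂ)).differentiableOn) hmaps
  have hFan : AnalyticOnNhd ℂ F upperHalfPlaneSet := hF.analyticOnNhd isOpen_upperHalfPlaneSet
  have hGan : AnalyticOnNhd ℂ (fun z ↦ F (z + 1)) upperHalfPlaneSet := hG.analyticOnNhd isOpen_upperHalfPlaneSet
  have hconn : IsPreconnected upperHalfPlaneSet := (convex_halfSpace_im_gt 0).isPreconnected
  set z₀ : ℂ := (max B 0 + 1 : ℝ) * Complex.I with hz₀def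
  have hz₀im : z₀.im = max B 0 + 1 := by simp [hz₀def]
  have hz₀ : z₀ ∈ upperHalfPlaneSet := by
    show 0 < z₀.im
    rw [hz₀im]; positivity
  have hev : F =ᶠ[𝓝 z₀] fun z ↦ F (z + 1) := by
    have hopen : IsOpen {z : ℂ | max B 0 < z.im} := isOpen_lt continuous_const Complex.continuous_im
    have hmem : z₀ ∈ {z : ℂ | max B 0 < z.im} := by
      show max B 0 < z₀.im
      rw [hz₀im]; linarith
    filter_upwards [hopen.mem_nhds hmem] with z hz
    have hz0 : 0 < z.im := lt_of_le_of_lt (le_max_right B 0) hz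
    have hzB : B < z.im := lt_of_le_of_lt (le_max_left B 0) hz
    have hz1 : 0 < (z + 1).im := by simpa using hz0
    simp only [hFdef, Function.comp_apply, ofComplex_apply_of_im_pos hz0, ofComplex_apply_of_im_pos hz1]
    exact (apply_eq_of_hasSum_of_lt_im hs hz0 hzB).symm
  have hEq := hFan.eqOn_of_preconnected_of_eventuallyEq hGan hconn hz₀ hev
  intro w
  by_cases hw : 0 < w.im
  · exact (hEq hw).symm
  · have hw : w.im ≤ 0 := not_lt.mp hw
    have hw1 : (w + 1).im ≤ 0 := by simpa using hw
    simp only [hFdef]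
    exact comp_ofComplex_of_im_le_zero f (w + 1) w hw1 hw

/-! ## §3 Boundedness at `i∞` -/

/-- **Boundedness at `i∞`** of a function given by a `q`-series for `Im τ > B`. [folklore] -/
theorem isBoundedAtImInfty_of_hasSum
    (hs : ∀ τ : ℍ, B < τ.im → HasSum (fun m ↦ c m * Periodic.qParam 1 (τ : ℂ) ^ m) (f τ)) :
    IsBoundedAtImInfty f := by
  -- a point `τ₁ = iB₁` with `B < B₁`: the series converges there, so its terms are bounded
  set B₁ : ℝ := max B 0 + 1 with hB₁
  have hB₁pos : 0 < B₁ := by rw [hB₁]; positivity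
  have hBB₁ : B < B₁ := by rw [hB₁]; linarith [le_max_left B 0]
  let τ₁ : ℍ := ⟨(B₁ : ℂ) * Complex.I, by simpa using hB₁pos⟩
  have hτ₁im : τ₁.im = B₁ := by simp [τ₁, UpperHalfPlane.im]
  set r₁ : ℝ := ‖Periodic.qParam 1 (τ₁ : ℂ)‖ with hr₁
  have hr₁eq : r₁ = Real.exp (-(2 * Real.pi * B₁)) := by rw [hr₁, norm_qParam_one, hτ₁im]
  have hr₁pos : 0 < r₁ := by rw [hr₁eq]; exact Real.exp_pos _
  have hlim := (hs τ₁ (by rw [hτ₁im]; exact hBB₁)).summable.tendsto_atTop_zero.norm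
  obtain ⟨M, hM⟩ := hlim.bddAbove_range
  have hMb : ∀ m, ‖c m‖ * r₁ ^ m ≤ M := fun m ↦ by
    have := hM ⟨m, rfl⟩
    simpa [norm_mul, norm_pow, hr₁] using this
  have hM0 : 0 ≤ M := le_trans (by positivity) (hMb 0)
  -- for `Im τ ≥ B₁ + 1` the terms are dominated by `M e^{-2πm}`
  set ρ : ℝ := Real.exp (-(2 * Real.pi)) with hρ
  have hρpos : 0 < ρ := Real.exp_pos _
  have hρlt : ρ < 1 := by rw [hρ]; exact Real.exp_lt_one_iff.mpr (by linarith [Real.pi_pos])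
  rw [isBoundedAtImInfty_iff]
  refine ⟨M * (1 - ρ)⁻¹, B₁ + 1, fun τ hτ ↦ ?_⟩
  have hτB : B < τ.im := by linarith
  have hq : ‖Periodic.qParam 1 (τ : ℂ)‖ ≤ r₁ * ρ := by
    rw [norm_qParam_one, hr₁eq, hρ, ← Real.exp_add]
    exact Real.exp_le_exp.mpr (by nlinarith [Real.pi_pos])
  have hterm : ∀ m, ‖c m * Periodic.qParam 1 (τ : ℂ) ^ m‖ ≤ M * ρ ^ m := fun m ↦ by
    rw [norm_mul, norm_pow]
    calc ‖c m‖ * ‖Periodic.qParam 1 (τ : ℂ)‖ ^ m ≤ ‖c m‖ * (r₁ * ρ) ^ m := by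
          gcongr
      _ = ‖c m‖ * r₁ ^ m * ρ ^ m := by rw [mul_pow]; ring
      _ ≤ M * ρ ^ m := by gcongr; exact hMb m
  have hgeom : HasSum (fun m : ℕ ↦ M * ρ ^ m) (M * (1 - ρ)⁻¹) :=
    (hasSum_geometric_of_lt_one hρpos.le hρlt).mul_left M
  exact (hs τ hτB).norm_le_of_bounded hgeom hterm

/-! ## §4 The series sums to `f` on all of `ℍ` -/

/-- The cusp function takes the value of the series at every `q ≠ 0` with `‖q‖ < e^{−2π·max(B,0)}`. [folklore] -/
theorem hasSum_cuspFunction_of_norm_lt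
    (hs : ∀ τ : ℍ, B < τ.im → HasSum (fun m ↦ c m * Periodic.qParam 1 (τ : ℂ) ^ m) (f τ))
    {q : ℂ} (hq : ‖q‖ < Real.exp (-(2 * Real.pi * max B 0))) (hq0 : q ≠ 0) :
    HasSum (fun m ↦ c m * q ^ m) (cuspFunction 1 f q) := by
  have hq1 : ‖q‖ < 1 := lt_of_lt_of_le hq (Real.exp_le_one_iff.mpr (by
    have := le_max_right B 0; nlinarith [Real.pi_pos]))
  have him := Periodic.im_invQParam_pos_of_norm_lt_one one_pos hq1 hq0
  let τ : ℍ := ⟨Periodic.invQParam 1 q, him⟩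
  have hτim : τ.im = -1 / (2 * Real.pi) * Real.log ‖q‖ := by
    simp [τ, UpperHalfPlane.im, Periodic.im_invQParam]
  have hτB : B < τ.im := by
    have hlog : Real.log ‖q‖ < -(2 * Real.pi * max B 0) := by
      rw [← Real.log_exp (-(2 * Real.pi * max B 0))]
      exact Real.log_lt_log (norm_pos_iff.mpr hq0) hq
    have h1 : max B 0 < τ.im := by
      rw [hτim]
      have hπ : 0 < 2 * Real.pi := by positivity
      rw [show -1 / (2 * Real.pi) * Real.log ‖q‖ = -Real.log ‖q‖ / (2 * Real.pi) by ring, lt_div_iff₀ hπ]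
      linarith
    exact lt_of_le_of_lt (le_max_left B 0) h1
  have hval : cuspFunction 1 f q = f τ := by
    have := Periodic.cuspFunction_eq_of_nonzero 1 (f ∘ ofComplex) hq0
    simpa [UpperHalfPlane.cuspFunction, Function.comp_apply, ofComplex_apply_of_im_pos him] using this
  have hqq : Periodic.qParam 1 (τ : ℂ) = q := by
    simpa [τ] using Periodic.qParam_right_inv one_ne_zero hq0
  rw [hval]
  simpa [hqq] using hs τ hτB

/-- The series is a power-series expansion of (the update at `0` of) the cusp function on the ball of radius `e^{−2π·max(B,0)}`. [folklore] -/
theorem hasFPowerSeriesOnBall_update_cuspFunction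
    (hs : ∀ τ : ℍ, B < τ.im → HasSum (fun m ↦ c m * Periodic.qParam 1 (τ : ℂ) ^ m) (f τ)) :
    HasFPowerSeriesOnBall (update (cuspFunction 1 f) 0 (c 0)) (FormalMultilinearSeries.ofScalars ℂ c) 0
      (ENNReal.ofReal (Real.exp (-(2 * Real.pi * max B 0)))) := by
  set R : ℝ := Real.exp (-(2 * Real.pi * max B 0)) with hR
  have hRpos : 0 < R := Real.exp_pos _
  constructor
  · refine le_of_forall_lt_imp_le_of_dense fun r hr ↦ ?_
    rcases eq_or_ne r 0 with rfl | hr'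
    · simp
    · have hrtop : r ≠ ⊤ := ne_top_of_lt hr
      lift r to NNReal using hrtop
      have hrR : (r : ℝ) < R := by
        have := (ENNReal.lt_ofReal_iff_toReal_lt ENNReal.coe_ne_top).mp hr
        simpa using this
      have hr0 : (r : ℂ) ≠ 0 := by exact_mod_cast (show (r : NNReal) ≠ 0 by exact_mod_cast hr')
      letI : FiniteDimensional ℝ ℂ := basisOneI.finiteDimensional_of_finite
      apply FormalMultilinearSeries.le_radius_of_summable
      have hsum := (hasSum_cuspFunction_of_norm_lt hs (q := (r : ℂ)) (by simpa using hrR) hr0).summable.norm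
      simpa [norm_mul, norm_pow, mul_comm] using hsum
  · simpa using hRpos
  · intro y hy
    have hy' : ‖y‖ < R := by
      rw [Metric.eball_ofReal, mem_ball_zero_iff] at hy
      exact hy
    rcases eq_or_ne y 0 with rfl | hy0
    · simpa +contextual [zero_pow_eq] using hasSum_ite_eq 0 (c 0)
    · simpa [update_of_ne hy0, mul_comm] using hasSum_cuspFunction_of_norm_lt hs hy' hy0

/-- **Main theorem.**  If `f : ℍ → ℂ` is holomorphic and `Σ cₘ q(τ)ᵐ` sums to `f τ` for `Im τ > B`, then it sums to `f τ` for
EVERY `τ ∈ ℍ`. [folklore] -/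
theorem hasSum_of_hasSum_of_lt_im (hf : MDifferentiable 𝓘(ℂ) 𝓘(ℂ) f)
    (hs : ∀ τ : ℍ, B < τ.im → HasSum (fun m ↦ c m * Periodic.qParam 1 (τ : ℂ) ^ m) (f τ)) (τ : ℍ) :
    HasSum (fun m ↦ c m * Periodic.qParam 1 (τ : ℂ) ^ m) (f τ) := by
  have hper := periodic_comp_ofComplex_of_hasSum hf hs
  have hbdd := isBoundedAtImInfty_of_hasSum hs
  have han : AnalyticAt ℂ (cuspFunction 1 f) 0 := analyticAt_cuspFunction_zero one_pos hper hf hbdd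
  -- the two power series of the cusp function at `0` coincide
  have h1 := (hasFPowerSeriesOnBall_update_cuspFunction hs).hasFPowerSeriesAt
  have h0 : c 0 = cuspFunction 1 f 0 := by
    have L1 := h1.continuousAt
    have L2 := han.continuousAt
    have := (L1.eventuallyEq_nhds_iff_eventuallyEq_nhdsNE L2).mp <| by
      filter_upwards [self_mem_nhdsWithin] with a ha using update_of_ne ha ..
    simpa [update_self] using this.eq_of_nhds
  rw [update_eq_self_iff.mpr h0] at h1
  have h2 : HasFPowerSeriesAt (cuspFunction 1 f)
      (FormalMultilinearSeries.ofScalars ℂ fun m ↦ (qExpansion 1 f).coeff m) 0 := by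
    simpa [qExpansion_coeff, div_eq_mul_inv, mul_comm] using han.hasFPowerSeriesAt
  have hcoeff : ∀ m, c m = (qExpansion 1 f).coeff m := fun m ↦ by
    simpa [FormalMultilinearSeries.coeff_ofScalars] using
      congr_arg (FormalMultilinearSeries.coeff · m) (h1.eq_formalMultilinearSeries h2)
  have := UpperHalfPlane.hasSum_qExpansion one_pos hper hf hbdd τ
  simpa [← hcoeff, smul_eq_mul] using this

/-- The main theorem in the `e^{2πiτn}` spelling of `UDCKummerLine.UnboundedDenominatorsWeight`. [folklore] -/
theorem hasSum_exp_of_hasSum_of_lt_im (hf : MDifferentiable 𝓘(ℂ) 𝓘(ℂ) f) {b : ℕ → ℂ}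
    (hs : ∀ τ : ℍ, B < τ.im → HasSum (fun n : ℕ ↦ b n * Complex.exp (2 * Real.pi * Complex.I * (τ : ℂ) * n)) (f τ))
    (τ : ℍ) : HasSum (fun n : ℕ ↦ b n * Complex.exp (2 * Real.pi * Complex.I * (τ : ℂ) * n)) (f τ) := by
  simp only [exp_eq_qParam_pow] at hs ⊢
  exact hasSum_of_hasSum_of_lt_im hf hs τ

end Summit.BirchSwinnertonDyer.BirchSwinnertonDyer.Theorems.ManinLocalTwoThree.QExpansionExtension

/-! ## §5 The C3 glue with the RELAXED `q`-expansion clause -/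

namespace Summit.BirchSwinnertonDyer.BirchSwinnertonDyer.Theorems.ManinLocalTwoThree.UDCGlue

open PowerSeries CongruenceSubgroup WeierstrassCurve Literature.NumberTheory.EllipticCurves
  Literature.NumberTheory.EllipticCurves.ModularForms
  Summit.BirchSwinnertonDyer.Rank1Residual.ManinAdditive.CuspidalKummer
  Summit.BirchSwinnertonDyer.Rank1Residual.ManinAdditive.CuspidalKummerThree
  Summit.BirchSwinnertonDyer.Rank1Residual.ManinAdditive.UDCKummerLine

/-- **(AN♮) ⟸ the RELAXED modular-form witness law** (integer `q`-expansion only for `Im τ > B`): the lead's glue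
`kummerCubeRootCongruenceOfBoundedOfUDC_of_modularFormWitness` (p727487) composed with `hasSum_exp_of_hasSum_of_lt_im`.
CONDITIONAL reduction; C3 OPEN; BSD is not proved by this. [folklore] -/
theorem kummerCubeRootCongruenceOfBoundedOfUDC_of_modularFormWitness_of_lt_im
    (hMF : ∀ (W : WeierstrassCurve ℚ) [W.IsElliptic] [W.IsGloballyMinimal] {N : ℕ} [NeZero N]
      (D : ModularParametrizationData W N) (a : ℕ → ℤ), (∀ n, (a n : ℂ) = cuspCoeff D.f n) →
      (∀ z ∈ D.L.lattice, ∃ w ∈ periodLattice D.f, z = D.c * w) →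
      ∀ X₀ Y₀ : ℚ, IsShortThreeTorsion W D.c X₀ Y₀ →
      ∀ u : ℂ, u ∉ D.L.lattice → 3 * u ∈ D.L.lattice →
      (D.c : ℂ) ^ 2 * D.L.weierstrassP u = (X₀ : ℂ) → (D.c : ℂ) ^ 3 * D.L.derivWeierstrassP u / 2 = (Y₀ : ℂ) →
      ∀ z : ℚ⟦X⟧, IsParamGerm W D.c a z →
      ∀ h : ℚ⟦X⟧, h ^ 3 = kummerCubeSeries W D.c X₀ Y₀ z → PowerSeries.constantCoeff h = -1 → IsThreeAdicallyBounded h →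
      ∃ (k : ℤ) (F : ℍ → ℂ), MDifferentiable 𝓘(ℂ) 𝓘(ℂ) F ∧
        (∀ γ : Gamma0 N, KummerPeriodTrivial D u γ → F ∣[k] (γ : SL(2, ℤ)) = F) ∧
        (∀ γ : Gamma0 N, F ∣[k] (γ : SL(2, ℤ)) = F → KummerPeriodTrivial D u γ) ∧
        (∀ g : SL(2, ℤ), ∃ C A m : ℝ, ∀ τ : ℍ, A ≤ τ.im → ‖(F ∣[k] g) τ‖ ≤ C * Real.exp (m * τ.im)) ∧
        (∃ (b : ℕ → ℤ) (B : ℝ), ∀ τ : ℍ, B < τ.im →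
          HasSum (fun n : ℕ ↦ (b n : ℂ) * Complex.exp (2 * Real.pi * Complex.I * (τ : ℂ) * n)) (F τ))) :
    KummerCubeRootCongruenceOfBoundedOfUDC := by
  refine kummerCubeRootCongruenceOfBoundedOfUDC_of_modularFormWitness ?_
  intro W _ _ N _ D a ha hopt X₀ Y₀ hT u hu h3u hX hY z hz h hh3 hh0 hb
  obtain ⟨k, F, hF, h1, h2, h3, b, B, hbB⟩ := hMF W D a ha hopt X₀ Y₀ hT u hu h3u hX hY z hz h hh3 hh0 hb
  exact ⟨k, F, hF, h1, h2, h3, b, fun τ ↦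
    QExpansionExtension.hasSum_exp_of_hasSum_of_lt_im hF (b := fun n ↦ (b n : ℂ)) hbB τ⟩

end Summit.BirchSwinnertonDyer.BirchSwinnertonDyer.Theorems.ManinLocalTwoThree.UDCGlue

end
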